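import Summits.QuantumFields.BalabanUV.Beta.FP.PeriodisedLamGaugeLegDoor
import Summits.QuantumFields.BalabanUV.Beta.FP.TorusSymGaugeCovariance

/-!
# `BalabanUV.Beta.FP.PeriodisedWardOrderOnePotentials` — road «FP» for binder row D1, ROUTE T under RULING R-D1-g52-1 (β1) ∕ the OWNER d1-p3's R-FP-74 (b)
# («the tower's `a1` CLOSES as `𝔎₁(v) W₀ + H₀ W₁(v) = 𝔔₀ᵀ Y₁(v)` = [the per-word letters] + [the companion words' rows, one storey up, storey by storey] —
# that bookkeeping is leaf-05's»): **THE STOREY LETTERS OF THE TOWER's `a1` CLOSING, AGAINST GRADIENTS OF ARBITRARY PERIODIC POTENTIALS, IN THE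
# NEXT AVERAGING ROWS' NORMAL FORM** — the inputs of the storey-by-storey bookkeeping, typed ONCE for every storey:
# * §1 `torus_Q10_level_apply` (+ `_gen`): the (0.4)-symmetrised averaging row between `M′` and `Lc·M′` at ANY level `j` entrywise = `stepScale d Lc j ·` the
#   level-0 row (`PeriodisedLamGaugeLegDoor.torus_Q10_levelZero_apply` lifted by `TorusSymGaugeCovariance.bhKStepSh_Dsh_inr_inl_eq_smul`); `_gen` = the same on a
#   finest torus `T = Lc·M′` given POINTWISE (`hT`) with a coarse-slot map `cp` (`(cp u : Site) = Lc • u`) — cast-free for the `towerTorus` spellings;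
# * §2 `tsum_coarse_regroup_pot` (+ `_gen`): `PeriodisedLamGaugeLegDoor.tsum_coarse_regroup` with the bracket GENERIC (any `M′`-periodic `Φ`) and the row at ANY
#   level: `Σ'_y c^per(μ,y)·Φ(y)·q¹_{(μ,y)}(v)∕2 = Σ_{y₀ ∈ pbox M′} c^per(μ,y₀)·Φ(y₀)·Q (y₀,μ) v ∕ (2·stepScale d Lc j·Lc^{d+1})`;
# * §3 `torus_a1_wilson_potentials`: the WILSON half of `a1` against the gradients `of (v e ↦ φ_e(v⁺) − φ_e(v))` of ANY family of `T`-periodic potentials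
#   (`PeriodisedFormGaugeLeg.sum_perZ_dper_wilsonA_mul_grad_periodic` in matrix form): `HW * W₀ + H₀ * W₁ = −(c∕2) • of (v e ↦ (H₀ h)_v · (φ_e(v) + φ_e(v⁺)))`;
# * §4 `torus_lamFamily_mul_grad_potentials` and **`torus_lamFamily_mul_grad_potentials_Q`**: the periodised Λ-family `G = w • Σ_ā h̄_ā • Λ_ā|ff` on a torus
#   `M₁ = Lc·M₂` (coefficients `c` GENERIC, periodised along the `M₂`-copies) against `κ •` the gradients of ANY family of `M₁`-periodic potentials `φ_e`:
#   un-regrouped (`PeriodisedLamGaugeLeg` §3's letter in matrix form: readings at the bond AND at the next storey's coarse endpoints `Lc•y + ρ_c (+ Lc•e_μ)`), and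
#   REGROUPED through the next (0.4) rows `Q` (level `j`, slot map `cp`) into the normal form
#   `G * D = (w κ ∕ (2·stepScale d Lc j·Lc^{d+1})) • (of (a e ↦ (Qᵀ Λʰ)_a · (φ_e(a) + φ_e(a⁺))) − Qᵀ * of (a′ e ↦ Λʰ_{a′} · (φ_e(Lc•a′ + ρ_c) + φ_e(Lc•a′ + ρ_c + Lc•e))))`,
#   `Λʰ_{a′} := Σ_ā h̄_ā · c^per_ā(a′.2, a′.1)` — the SAME normal form as `PeriodisedLamGaugeLegDoor.torus_a1_lam_Q10` (`hLam` of `PeriodisedWardOrderOneCompanion.a1_total_eq_zero`):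
#   at `κ = 1`, `(M₁, M₂) = (finest, first storey)` it is the Λ half of the BOTTOM tables; at `(M₁, M₂) = (storey k, storey k+1)` with `κ = ∏ stepScale·#B` it is the
#   storey-`k` COMPANION's Ward reading one storey up (the diagonal multiplier reading, and the storey-`(k+1)` endpoint readings pulled back through `Qᵀ` — what the
#   storey above cancels; at the top they vanish on residual parameters, `PeriodisedWardOrderOneCompanion.tdelta_root_res_eq_zero`);
# * §5 `tgrad_ff_mul_eq_of_grad`: ANY family `C` of gauge functions on the torus sites, pushed through the torus gradient, IS the gradient family of the periodic
#   potentials `φ_e := C (wrapPt ·) e` — the bridge from leaf-02's covariance images `(tgrad M)|ff * C.submatrix itRoot id` (`TorusCompositeCovarianceSym.compRowsSym_mul_tgrad_mul`)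
#   to §3 ∕ §4's potential form.
# So every INPUT of the storey step of R-FP-74 (b)'s closing (`hWil`, `hLam`, `hcov` by leaf-02, `hcomp` with remainder) is ONE letter at every storey; what the
# closing adds is the K1 row at the bottom, one (K1′)-type link per storey and the induction — the OWNER's ∕ an2's naming (R-FP-74 (b), Q-FP-33-1).
# [folklore] finite sums ∕ `tsum` regrouping BY NAME over OUR typed objects; no `def`, no `def … : Prop`, nothing cited, 0 sorry; 0 estimates; discharges NO row by itself.

HONEST DEPENDENCY (page 1, mandatory): continuum YM on T⁴ ⇐ BetaPertH ∧ nine spine estimates (0/9 proved); BetaPertH ⇐ (D1) ∧ (D4) ∧ CAP+tail;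
G-an2-4 gates asym, D1 and NE2/3/4.  HONEST FRAMING (cell contract, verbatim): «discharging `BetaPertH` makes Bałaban's UV stability UNCONDITIONAL —
a real constructive-QFT result; it is NOT the continuum limit and NOT the Clay problem.»  ABSOLUTE RULE (cell charter, verbatim): «No internally-minted
statement may enter as a cited fact. Every hypothesis is either kernel-proved in this package or a verbatim quotation of a PUBLISHED theorem with page
reference. The manuscript(s) under audit are NOT citable for their own disputed steps — they are the thing under adjudication; programme-internal
(2001/route/tribunal) claims are never citable.»  Nothing of Bałaban's ∕ the dictionary's asserted; 0∕4 row-D1 binders (hW, hR, D1Tel, D1Rep); ROOT M‴ p325680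
untouched; NOT (C1), NOT (T-ID), NOT SDF, NOT D1, NEVER «G-an2-4 closed», NOT BetaPertH, NOT continuum, NOT Clay.  «not in print; our bookkeeping».
Unit `b2b-balaban-beta-d1-formalise-leaf-05` (gen 44; seeds of gen 43), 2026-08-24; no existing file touched.
-/

noncomputable section

namespace Summit.QuantumFields.BalabanUV.Beta.FP.PeriodisedWardOrderOnePotentials

open scoped BigOperators Matrix
open Finset Matrix
open Literature.MathematicalPhysics.QuantumFieldTheory.Balaban1983to89
open Literature.MathematicalPhysics.QuantumFieldTheory.Balaban1983to89.Beta
open B4TorusKernel.MultiPeriod (translate)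
open B5Prop11Plancherel (fine)
open B6Lemma24Torus (pbox mem_pbox)
open ExpKernelCalculus (MKer)
open AffineAveraging (Site box toSite unitVec)
open AveragingContoursRooted (ctr ctrOff ctrOff_mem_box)
open OneStepResolventKernel (Fib)
open InterLevelTransport (SLam)
open StepJetData (wilsonA)
open Summit.QuantumFields.BalabanUV.Beta.SymAveragingHessianCounts (symHessFFAt symLinKerAt symLinKerAt_eq_zero)
open Summit.QuantumFields.BalabanUV.Beta.BorderedHessian (bhKStepAt stepScale)
open Summit.QuantumFields.BalabanUV.Beta.DshAn1 (Dsh)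
open Summit.QuantumFields.BalabanUV.Beta.SymShiftedSpread (bhKStepSh bhKStepSh_zero)
open Summit.QuantumFields.BalabanUV.Beta.FP.KernelPeriodisationFib (Idx perF perF_apply perZ perZ_apply)
open Summit.QuantumFields.BalabanUV.Beta.FP.KernelPeriodisationFibLoc (dper)
open Summit.QuantumFields.BalabanUV.Beta.FP.KernelPeriodisationFibTrace (tsum_sites_eq_sum_tsum)
open Summit.QuantumFields.BalabanUV.Beta.FP.TorusGaugeCovariance (tdelta tgrad tgrad_inl)
open Summit.QuantumFields.BalabanUV.Beta.FP.TorusGaugeCovarianceCoarse (coarsePt coarsePt_coe)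
open Summit.QuantumFields.BalabanUV.Beta.FP.TorusGaugeCovariancePairing (wrapPt wrapPt_of_mem sum_tdelta_mul)
open Summit.QuantumFields.BalabanUV.Beta.LinearGaugeVH (summable_of_finsupp)
open Summit.QuantumFields.BalabanUV.Beta.GAN24.HessianGaugeLegContact (exists_finset_near)
open Summit.QuantumFields.BalabanUV.Beta.FP.PeriodisedFormGaugeLeg (sum_perZ_dper_wilsonA_mul_grad_periodic)
open Summit.QuantumFields.BalabanUV.Beta.FP.PeriodisedLamGaugeLeg (sum_perZ_dper_SLam_symHessFFAt_mul_grad_periodic)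
open Summit.QuantumFields.BalabanUV.Beta.FP.PeriodisedLamGaugeLegDoor (torus_Q10_levelZero_apply cper_translate coarseEnd_translate bookkeeping)
open Summit.QuantumFields.BalabanUV.Beta.FP.TorusSymGaugeCovariance (bhKStepSh_Dsh_inr_inl_eq_smul)

variable {d : ℕ} (M' : Fin (d + 1) → ℕ) [∀ μ, NeZero (M' μ)] (Lc : ℕ) [NeZero Lc]

/-! ## §1 The (0.4)-symmetrised averaging row at ANY level `j`, entrywise -/

omit [∀ μ, NeZero (M' μ)] in
/-- **[folklore] `torus_Q10_level_apply`** — the level-`j` sym averaging row on `fine Lc M′` (coarse slot `(coarsePt M′ Lc a.1, inr a.2)`; leaf-06's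
`QstepSym Lc M′ j` by `rfl`) entrywise: `Q a v = stepScale d Lc j · (Lc^{d+1} · Σ'_k symLinKerAt (ctr (d+1) Lc) Lc a.2 (a.1 + M′∘k) (v.2, v.1))`
(`torus_Q10_levelZero_apply` and `bhKStepSh_Dsh_inr_inl_eq_smul`: the multiplier–field entry at level `j` is `stepScale d Lc j ·` the level-0 entry). -/
theorem torus_Q10_level_apply (j : ℕ)
    {Q : Matrix (↥(pbox M') × Fin (d + 1)) (↥(pbox (fine Lc M')) × Fin (d + 1)) ℝ}
    (hQ : Q = (perF (fine Lc M') (bhKStepSh d Lc (Dsh Lc) j)).submatrix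
        (fun a : ↥(pbox M') × Fin (d + 1) => ((coarsePt M' Lc a.1, Sum.inr a.2) : Idx (fine Lc M') (Fib d)))
        (fun b : ↥(pbox (fine Lc M')) × Fin (d + 1) => ((b.1, Sum.inl b.2) : Idx (fine Lc M') (Fib d))))
    (a : ↥(pbox M') × Fin (d + 1)) (v : ↥(pbox (fine Lc M')) × Fin (d + 1)) :
    Q a v = stepScale d Lc j * ((Lc : ℝ) ^ (d + 1) *
      ∑' k : Site (d + 1), symLinKerAt (ctr (d + 1) Lc) Lc a.2 (translate M' (a.1 : Site (d + 1)) k) (v.2, (v.1 : Site (d + 1)))) := by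
  have h0 := torus_Q10_levelZero_apply M' Lc (Q₁₀ := (perF (fine Lc M') (bhKStepSh d Lc (Dsh Lc) 0)).submatrix
        (fun a : ↥(pbox M') × Fin (d + 1) => ((coarsePt M' Lc a.1, Sum.inr a.2) : Idx (fine Lc M') (Fib d)))
        (fun b : ↥(pbox (fine Lc M')) × Fin (d + 1) => ((b.1, Sum.inl b.2) : Idx (fine Lc M') (Fib d)))) rfl a v
  rw [Matrix.submatrix_apply, perF_apply, perZ_apply] at h0
  rw [hQ, Matrix.submatrix_apply, perF_apply, perZ_apply, ← h0, ← tsum_mul_left]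
  refine tsum_congr fun m => ?_
  rw [bhKStepSh_Dsh_inr_inl_eq_smul, bhKStepSh_zero]

omit [∀ μ, NeZero (M' μ)] in
/-- **[folklore] `torus_Q10_level_apply_gen`** — the same on ANY finest torus `T` with `T = Lc·M′` POINTWISE (`hT`; e.g. the `towerTorus` spellings) and ANY
coarse-slot map `cp` onto the `Lc`-multiples (`(cp u : Site) = Lc • u`; at `T = fine Lc M′` it is `coarsePt`) — cast-free. -/
theorem torus_Q10_level_apply_gen (T : Fin (d + 1) → ℕ) [∀ μ, NeZero (T μ)] (hT : ∀ i, T i = Lc * M' i)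
    (cp : ↥(pbox M') → ↥(pbox T)) (hcp : ∀ u : ↥(pbox M'), ((cp u : ↥(pbox T)) : Site (d + 1)) = (Lc : ℤ) • (u : Site (d + 1))) (j : ℕ)
    {Q : Matrix (↥(pbox M') × Fin (d + 1)) (↥(pbox T) × Fin (d + 1)) ℝ}
    (hQ : Q = (perF T (bhKStepSh d Lc (Dsh Lc) j)).submatrix
        (fun a : ↥(pbox M') × Fin (d + 1) => ((cp a.1, Sum.inr a.2) : Idx T (Fib d)))
        (fun b : ↥(pbox T) × Fin (d + 1) => ((b.1, Sum.inl b.2) : Idx T (Fib d))))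
    (a : ↥(pbox M') × Fin (d + 1)) (v : ↥(pbox T) × Fin (d + 1)) :
    Q a v = stepScale d Lc j * ((Lc : ℝ) ^ (d + 1) *
      ∑' k : Site (d + 1), symLinKerAt (ctr (d + 1) Lc) Lc a.2 (translate M' (a.1 : Site (d + 1)) k) (v.2, (v.1 : Site (d + 1)))) := by
  obtain rfl : T = fine Lc M' := funext hT
  have hcp' : ∀ u : ↥(pbox M'), cp u = coarsePt M' Lc u := fun u => Subtype.ext (by rw [hcp, coarsePt_coe])
  have hQ' : Q = (perF (fine Lc M') (bhKStepSh d Lc (Dsh Lc) j)).submatrix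
        (fun a : ↥(pbox M') × Fin (d + 1) => ((coarsePt M' Lc a.1, Sum.inr a.2) : Idx (fine Lc M') (Fib d)))
        (fun b : ↥(pbox (fine Lc M')) × Fin (d + 1) => ((b.1, Sum.inl b.2) : Idx (fine Lc M') (Fib d))) := by
    rw [hQ]; ext a' b'; simp only [Matrix.submatrix_apply, hcp']
  exact torus_Q10_level_apply M' Lc j hQ' a v

/-! ## §2 The coarse period sum regrouped over the coarse torus through the level-`j` rows — GENERIC bracket -/

/-- **[folklore] `tsum_coarse_regroup_pot`** — for a `c`-row periodised along the coarse copies, an `M′`-periodic bracket `Φ` and the level-`j` rows `Q`,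
`Σ'_y c^per(μ,y) · (Φ y · q¹_{(μ,y)}(v) ∕ 2) = Σ_{y₀ ∈ pbox M′} c^per(μ,y₀) · Φ y₀ · Q (y₀,μ) v ∕ (2 · (stepScale d Lc j · Lc^{d+1}))`
(`PeriodisedLamGaugeLegDoor.tsum_coarse_regroup`'s argument: finite support near `v`, `tsum_sites_eq_sum_tsum`, `cper_translate`, §1). -/
theorem tsum_coarse_regroup_pot (j : ℕ)
    {Q : Matrix (↥(pbox M') × Fin (d + 1)) (↥(pbox (fine Lc M')) × Fin (d + 1)) ℝ}
    (hQ : Q = (perF (fine Lc M') (bhKStepSh d Lc (Dsh Lc) j)).submatrix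
        (fun a : ↥(pbox M') × Fin (d + 1) => ((coarsePt M' Lc a.1, Sum.inr a.2) : Idx (fine Lc M') (Fib d)))
        (fun b : ↥(pbox (fine Lc M')) × Fin (d + 1) => ((b.1, Sum.inl b.2) : Idx (fine Lc M') (Fib d))))
    (c : Fin (d + 1) → Site (d + 1) → Fin (d + 1) → Site (d + 1) → ℝ) (κ' : Fin (d + 1)) (u : Site (d + 1)) (μ : Fin (d + 1))
    (v : ↥(pbox (fine Lc M')) × Fin (d + 1)) {Φ : Site (d + 1) → ℝ} (hΦ : ∀ y k : Site (d + 1), Φ (translate M' y k) = Φ y) :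
    ∑' y : Site (d + 1), (∑' m : Site (d + 1), c μ (translate M' y m) κ' u) *
        (Φ y * symLinKerAt (toSite (ctrOff (d + 1) Lc)) Lc μ y (v.2, (v.1 : Site (d + 1))) / 2)
      = ∑ y₀ : ↥(pbox M'), (∑' m : Site (d + 1), c μ (translate M' (y₀ : Site (d + 1)) m) κ' u) * Φ y₀
          * Q (y₀, μ) v / (2 * (stepScale d Lc j * (Lc : ℝ) ^ (d + 1))) := by
  classical
  have hLc1 : 1 ≤ Lc := Nat.one_le_iff_ne_zero.mpr (NeZero.ne Lc)
  have hsc : stepScale d Lc j * (Lc : ℝ) ^ (d + 1) ≠ 0 := by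
    refine mul_ne_zero ?_ (pow_ne_zero _ (Nat.cast_ne_zero.2 (NeZero.ne Lc)))
    simp only [stepScale]
    exact pow_ne_zero _ (pow_ne_zero _ (Nat.cast_ne_zero.2 (NeZero.ne Lc)))
  have hr := ctrOff_mem_box (d := d + 1) hLc1
  obtain ⟨s, hs⟩ := exists_finset_near (d := d) hLc1 (v.1 : Site (d + 1))
  have hsumm : Summable fun y : Site (d + 1) => (∑' m : Site (d + 1), c μ (translate M' y m) κ' u) *
      (Φ y * symLinKerAt (toSite (ctrOff (d + 1) Lc)) Lc μ y (v.2, (v.1 : Site (d + 1))) / 2) :=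
    summable_of_finsupp s fun y hy => by
      rw [symLinKerAt_eq_zero hr (f := (v.2, (v.1 : Site (d + 1)))) (fun hn => hy (hs y hn))]
      ring
  rw [tsum_sites_eq_sum_tsum M' hsumm]
  refine Finset.sum_congr rfl fun y₀ _ => ?_
  have per : ∀ k : Site (d + 1),
      (∑' m : Site (d + 1), c μ (translate M' (translate M' (y₀ : Site (d + 1)) k) m) κ' u) *
          (Φ (translate M' (y₀ : Site (d + 1)) k)
            * symLinKerAt (toSite (ctrOff (d + 1) Lc)) Lc μ (translate M' (y₀ : Site (d + 1)) k) (v.2, (v.1 : Site (d + 1))) / 2)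
        = ((∑' m : Site (d + 1), c μ (translate M' (y₀ : Site (d + 1)) m) κ' u) * Φ y₀ / 2)
            * symLinKerAt (toSite (ctrOff (d + 1) Lc)) Lc μ (translate M' (y₀ : Site (d + 1)) k) (v.2, (v.1 : Site (d + 1))) := fun k => by
    rw [cper_translate M' c μ (y₀ : Site (d + 1)) k κ' u, hΦ]
    ring
  have hq : ∑' k : Site (d + 1), symLinKerAt (toSite (ctrOff (d + 1) Lc)) Lc μ (translate M' (y₀ : Site (d + 1)) k) (v.2, (v.1 : Site (d + 1)))
      = Q (y₀, μ) v / (stepScale d Lc j * (Lc : ℝ) ^ (d + 1)) := by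
    rw [eq_div_iff hsc, torus_Q10_level_apply M' Lc j hQ (y₀, μ) v]
    show _ = stepScale d Lc j * ((Lc : ℝ) ^ (d + 1) *
      ∑' k : Site (d + 1), symLinKerAt (toSite (ctrOff (d + 1) Lc)) Lc μ (translate M' (y₀ : Site (d + 1)) k) (v.2, (v.1 : Site (d + 1))))
    ring
  rw [tsum_congr per, tsum_mul_left, hq]
  field_simp

/-- **[folklore] `tsum_coarse_regroup_pot_gen`** — §2 on ANY finest torus `T = Lc·M′` pointwise with a coarse-slot map `cp` (cast-free). -/
theorem tsum_coarse_regroup_pot_gen (T : Fin (d + 1) → ℕ) [∀ μ, NeZero (T μ)] (hT : ∀ i, T i = Lc * M' i)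
    (cp : ↥(pbox M') → ↥(pbox T)) (hcp : ∀ u : ↥(pbox M'), ((cp u : ↥(pbox T)) : Site (d + 1)) = (Lc : ℤ) • (u : Site (d + 1))) (j : ℕ)
    {Q : Matrix (↥(pbox M') × Fin (d + 1)) (↥(pbox T) × Fin (d + 1)) ℝ}
    (hQ : Q = (perF T (bhKStepSh d Lc (Dsh Lc) j)).submatrix
        (fun a : ↥(pbox M') × Fin (d + 1) => ((cp a.1, Sum.inr a.2) : Idx T (Fib d)))
        (fun b : ↥(pbox T) × Fin (d + 1) => ((b.1, Sum.inl b.2) : Idx T (Fib d))))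
    (c : Fin (d + 1) → Site (d + 1) → Fin (d + 1) → Site (d + 1) → ℝ) (κ' : Fin (d + 1)) (u : Site (d + 1)) (μ : Fin (d + 1))
    (v : ↥(pbox T) × Fin (d + 1)) {Φ : Site (d + 1) → ℝ} (hΦ : ∀ y k : Site (d + 1), Φ (translate M' y k) = Φ y) :
    ∑' y : Site (d + 1), (∑' m : Site (d + 1), c μ (translate M' y m) κ' u) *
        (Φ y * symLinKerAt (toSite (ctrOff (d + 1) Lc)) Lc μ y (v.2, (v.1 : Site (d + 1))) / 2)
      = ∑ y₀ : ↥(pbox M'), (∑' m : Site (d + 1), c μ (translate M' (y₀ : Site (d + 1)) m) κ' u) * Φ y₀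
          * Q (y₀, μ) v / (2 * (stepScale d Lc j * (Lc : ℝ) ^ (d + 1))) := by
  obtain rfl : T = fine Lc M' := funext hT
  have hcp' : ∀ u : ↥(pbox M'), cp u = coarsePt M' Lc u := fun u => Subtype.ext (by rw [hcp, coarsePt_coe])
  have hQ' : Q = (perF (fine Lc M') (bhKStepSh d Lc (Dsh Lc) j)).submatrix
        (fun a : ↥(pbox M') × Fin (d + 1) => ((coarsePt M' Lc a.1, Sum.inr a.2) : Idx (fine Lc M') (Fib d)))
        (fun b : ↥(pbox (fine Lc M')) × Fin (d + 1) => ((b.1, Sum.inl b.2) : Idx (fine Lc M') (Fib d))) := by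
    rw [hQ]; ext a' b'; simp only [Matrix.submatrix_apply, hcp']
  exact tsum_coarse_regroup_pot M' Lc j hQ' c κ' u μ v hΦ

/-! ## §3 The WILSON half of `a1` against gradients of arbitrary periodic potentials -/

omit [∀ μ, NeZero (M' μ)] [NeZero Lc] in
/-- **[folklore] `torus_a1_wilson_potentials` — THE WILSON SECTOR OF `a1` AGAINST GRADIENTS OF ANY FAMILY OF PERIODIC POTENTIALS.**  On a torus `T`, for any bond
weight `h`, any `c`, any family `φ : γ → Site → ℝ` of `T`-periodic potentials, with `W₀ = of (v e ↦ φ_e(v.1 + e_{v.2}) − φ_e(v.1))` (the gradient columns),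
`W₁ = of (b e ↦ −(c · h b · φ_e(b.1 + e_{b.2})))` (the first jet's shape, #21) and `H₀ = (perF T (bhKStepAt d ρ L 0))|ff`:
`((−2c) • Σ_b h b • (perF T (dper T (wilsonA d b.2 b.1)))|ff) * W₀ + H₀ * W₁ = −(c∕2) • of (v e ↦ (H₀ *ᵥ h) v · (φ_e(v.1) + φ_e(v.1 + e_{v.2})))`
(`PeriodisedFormGaugeLeg.sum_perZ_dper_wilsonA_mul_grad_periodic` per index bond; `torus_a1_wilson` ∕ `torus_a1_wilson_tower` are the instances at the
mode potentials). -/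
theorem torus_a1_wilson_potentials (T : Fin (d + 1) → ℕ) [∀ μ, NeZero (T μ)] (ρ : Site (d + 1)) (L : ℕ) [NeZero L]
    (c : ℝ) (h : ↥(pbox T) × Fin (d + 1) → ℝ) {γ : Type*} (φ : γ → Site (d + 1) → ℝ) (hφ : ∀ e z m, φ e (translate T z m) = φ e z)
    {H₀ : Matrix (↥(pbox T) × Fin (d + 1)) (↥(pbox T) × Fin (d + 1)) ℝ}
    (hH₀ : H₀ = (perF T (bhKStepAt d ρ L 0)).submatrix
        (fun b : ↥(pbox T) × Fin (d + 1) => ((b.1, Sum.inl b.2) : Idx T (Fib d)))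
        (fun b : ↥(pbox T) × Fin (d + 1) => ((b.1, Sum.inl b.2) : Idx T (Fib d))))
    {W₀ : Matrix (↥(pbox T) × Fin (d + 1)) γ ℝ}
    (hW₀ : W₀ = Matrix.of fun (v : ↥(pbox T) × Fin (d + 1)) (e : γ) => φ e ((v.1 : Site (d + 1)) + unitVec v.2) - φ e (v.1 : Site (d + 1)))
    {W₁ : Matrix (↥(pbox T) × Fin (d + 1)) γ ℝ}
    (hW₁ : W₁ = Matrix.of fun (b : ↥(pbox T) × Fin (d + 1)) (e : γ) => -(c * h b * φ e ((b.1 : Site (d + 1)) + unitVec b.2))) :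
    ((-2 * c) • ∑ b : ↥(pbox T) × Fin (d + 1), h b •
          (perF T (dper T (wilsonA d b.2 (b.1 : Site (d + 1))))).submatrix
            (fun b : ↥(pbox T) × Fin (d + 1) => ((b.1, Sum.inl b.2) : Idx T (Fib d)))
            (fun b : ↥(pbox T) × Fin (d + 1) => ((b.1, Sum.inl b.2) : Idx T (Fib d))))
        * W₀ + H₀ * W₁
      = -(c / 2) • Matrix.of (fun (v : ↥(pbox T) × Fin (d + 1)) (e : γ) =>
          H₀.mulVec h v * (φ e (v.1 : Site (d + 1)) + φ e ((v.1 : Site (d + 1)) + unitVec v.2))) := by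
  have hH0 : ∀ v b : ↥(pbox T) × Fin (d + 1),
      H₀ v b = perZ T (bhKStepAt d ρ L 0) (v.1 : Site (d + 1)) (b.1 : Site (d + 1)) (Sum.inl v.2) (Sum.inl b.2) := fun v b => by
    rw [hH₀]; rfl
  have hW1 : ∀ (b' : ↥(pbox T) × Fin (d + 1)) (e : γ), W₁ b' e = h b' * (-c * φ e ((b'.1 : Site (d + 1)) + unitVec b'.2)) := fun b' e => by
    rw [hW₁, Matrix.of_apply]; ring
  have hWD : ∀ (b v : ↥(pbox T) × Fin (d + 1)) (e : γ),
      ((perF T (dper T (wilsonA d b.2 (b.1 : Site (d + 1))))).submatrix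
            (fun b : ↥(pbox T) × Fin (d + 1) => ((b.1, Sum.inl b.2) : Idx T (Fib d)))
            (fun b : ↥(pbox T) × Fin (d + 1) => ((b.1, Sum.inl b.2) : Idx T (Fib d))) * W₀) v e
        = -((1 / 2 : ℝ) * (φ e ((b.1 : Site (d + 1)) + unitVec b.2) - (φ e (v.1 : Site (d + 1)) + φ e ((v.1 : Site (d + 1)) + unitVec v.2)) / 2)
            * perZ T (bhKStepAt d ρ L 0) (v.1 : Site (d + 1)) (b.1 : Site (d + 1)) (Sum.inl v.2) (Sum.inl b.2)) := fun b v e => by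
    rw [hW₀, Matrix.mul_apply, Fintype.sum_prod_type]
    simp only [Matrix.submatrix_apply, perF_apply, Matrix.of_apply]
    exact sum_perZ_dper_wilsonA_mul_grad_periodic T ρ L b.2 (b.1 : Site (d + 1)) (v.1 : Site (d + 1)) v.2 (hφ e)
  ext v e
  rw [Matrix.add_apply, Matrix.smul_apply, Matrix.of_apply, Matrix.smul_mul, Matrix.sum_mul, Matrix.smul_apply, Matrix.sum_apply, Matrix.mul_apply]
  simp only [hW1, Matrix.mulVec, dotProduct, hH0, Matrix.smul_mul, Matrix.smul_apply, hWD, smul_eq_mul]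
  rw [Finset.mul_sum, Finset.sum_mul, Finset.mul_sum, ← Finset.sum_add_distrib]
  refine Finset.sum_congr rfl fun b _ => ?_
  ring

/-! ## §4 The periodised Λ-FAMILY against `κ •` gradients of arbitrary periodic potentials: un-regrouped, and in the next rows' normal form -/

/-- **[folklore] `torus_lamFamily_mul_grad_potentials`** — on `M₁ = Lc·M₂` (`hM₁`), the periodised Λ-family along a bond weight `h̄` with weight `w`,
`G = w • Σ_ā h̄_ā • (perF M₁ (dper M₁ (SLam N c (symHessFFAt ρ_c Lc) ā)))|ff` (coefficients `c` GENERIC, summable along the `M₂`-copies, `ρ_c = toSite (ctrOff (d+1) Lc)`),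
against `D = κ • of (a e ↦ φ_e(a.1 + e_{a.2}) − φ_e(a.1))` for ANY family of `M₁`-periodic potentials:
`(G · D)_{a,e} = wκ · Σ_ā h̄_ā Σ_μ Σ'_y c^per_ā(μ,y) · (φ_e(a) + φ_e(a⁺) − φ_e(Lc•y + ρ_c) − φ_e(Lc•y + ρ_c + Lc•e_μ)) · q¹_{(μ,y)}(a) ∕ 2`
(`PeriodisedLamGaugeLeg.sum_perZ_dper_SLam_symHessFFAt_mul_grad_periodic` per family member and column) — the readings at the bond `a` AND at the NEXT storey's
coarse endpoints (`PeriodisedWardOrderOneCompanion.torus_companion_mul_Dbar` is the top instance, where the latter vanish). -/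
theorem torus_lamFamily_mul_grad_potentials {N : ℕ} [NeZero N] (M₁ : Fin (d + 1) → ℕ) [∀ μ, NeZero (M₁ μ)] {M₂ : Fin (d + 1) → ℕ}
    (hM₁ : ∀ i, M₁ i = Lc * M₂ i) (c : Fin (d + 1) → Site (d + 1) → Fin (d + 1) → Site (d + 1) → ℝ)
    (hc : ∀ κ' u μ y, Summable fun m : Site (d + 1) => c μ (translate M₂ y m) κ' u)
    (w κ : ℝ) (hbar : ↥(pbox M₁) × Fin (d + 1) → ℝ)
    {G : Matrix (↥(pbox M₁) × Fin (d + 1)) (↥(pbox M₁) × Fin (d + 1)) ℝ}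
    (hG : G = w • ∑ a : ↥(pbox M₁) × Fin (d + 1), hbar a •
        (perF M₁ (dper M₁ (SLam N c (fun μ y => symHessFFAt (toSite (ctrOff (d + 1) Lc)) Lc μ y) a.2 (a.1 : Site (d + 1))))).submatrix
          (fun b : ↥(pbox M₁) × Fin (d + 1) => ((b.1, Sum.inl b.2) : Idx M₁ (Fib d)))
          (fun b : ↥(pbox M₁) × Fin (d + 1) => ((b.1, Sum.inl b.2) : Idx M₁ (Fib d))))
    {γ : Type*} (φ : γ → Site (d + 1) → ℝ) (hφ : ∀ e z m, φ e (translate M₁ z m) = φ e z)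
    {D : Matrix (↥(pbox M₁) × Fin (d + 1)) γ ℝ}
    (hD : D = κ • Matrix.of fun (a : ↥(pbox M₁) × Fin (d + 1)) (e : γ) => φ e ((a.1 : Site (d + 1)) + unitVec a.2) - φ e (a.1 : Site (d + 1))) :
    G * D = Matrix.of fun (a : ↥(pbox M₁) × Fin (d + 1)) (e : γ) =>
      w * κ * ∑ ā : ↥(pbox M₁) × Fin (d + 1), hbar ā *
        ∑ μ : Fin (d + 1), ∑' y : Site (d + 1), (∑' m : Site (d + 1), c μ (translate M₂ y m) ā.2 (ā.1 : Site (d + 1)))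
          * ((φ e (a.1 : Site (d + 1)) + φ e ((a.1 : Site (d + 1)) + unitVec a.2)
                - φ e ((Lc : ℤ) • y + toSite (ctrOff (d + 1) Lc)) - φ e ((Lc : ℤ) • y + toSite (ctrOff (d + 1) Lc) + (Lc : ℤ) • unitVec μ))
              * symLinKerAt (toSite (ctrOff (d + 1) Lc)) Lc μ y (a.2, (a.1 : Site (d + 1))) / 2) := by
  have hLc1 : 1 ≤ Lc := Nat.one_le_iff_ne_zero.mpr (NeZero.ne Lc)
  -- one family member against one potential column
  have hF : ∀ (ā a : ↥(pbox M₁) × Fin (d + 1)) (e : γ),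
      ((perF M₁ (dper M₁ (SLam N c (fun μ y => symHessFFAt (toSite (ctrOff (d + 1) Lc)) Lc μ y) ā.2 (ā.1 : Site (d + 1))))).submatrix
            (fun b : ↥(pbox M₁) × Fin (d + 1) => ((b.1, Sum.inl b.2) : Idx M₁ (Fib d)))
            (fun b : ↥(pbox M₁) × Fin (d + 1) => ((b.1, Sum.inl b.2) : Idx M₁ (Fib d)))
          * Matrix.of (fun (a : ↥(pbox M₁) × Fin (d + 1)) (e : γ) => φ e ((a.1 : Site (d + 1)) + unitVec a.2) - φ e (a.1 : Site (d + 1)))) a e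
        = ∑ μ : Fin (d + 1), ∑' y : Site (d + 1), (∑' m : Site (d + 1), c μ (translate M₂ y m) ā.2 (ā.1 : Site (d + 1))) *
            ((φ e (a.1 : Site (d + 1)) + φ e ((a.1 : Site (d + 1)) + unitVec a.2)
                - φ e ((Lc : ℤ) • y + toSite (ctrOff (d + 1) Lc)) - φ e ((Lc : ℤ) • y + toSite (ctrOff (d + 1) Lc) + (Lc : ℤ) • unitVec μ))
              * symLinKerAt (toSite (ctrOff (d + 1) Lc)) Lc μ y (a.2, (a.1 : Site (d + 1))) / 2) := by
    intro ā a e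
    rw [Matrix.mul_apply, Fintype.sum_prod_type]
    simp only [Matrix.submatrix_apply, perF_apply, Matrix.of_apply]
    exact sum_perZ_dper_SLam_symHessFFAt_mul_grad_periodic M₁ (M' := M₂) (L := Lc) (N := N) hM₁ hLc1
      (ctrOff_mem_box (d := d + 1) hLc1) c ā.2 (ā.1 : Site (d + 1)) (hc ā.2 _) (a.1 : Site (d + 1)) a.2 (φ := φ e) (hφ e)
  rw [hG, hD, Matrix.smul_mul, Matrix.mul_smul, Matrix.sum_mul]
  ext a e
  simp only [Matrix.smul_apply, Matrix.sum_apply, Matrix.smul_mul, smul_eq_mul, hF]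
  exact (mul_assoc w κ _).symm

set_option synthInstance.maxSize 1024 in
/-- **[folklore] `torus_lamFamily_mul_grad_potentials_Q` — THE Λ-FAMILY's WARD READING IN THE NEXT ROWS' NORMAL FORM.**  §4's reading REGROUPED through the
(0.4) rows `Q` between `M₂` and `M₁` (level `j`, slot map `cp` with `(cp u : Site) = Lc • u`):
`G * D = (wκ ∕ (2·(stepScale d Lc j·Lc^{d+1}))) • (of (a e ↦ (Qᵀ *ᵥ Λʰ) a · (φ_e(a) + φ_e(a⁺))) − Qᵀ * of (a′ e ↦ Λʰ a′ · (φ_e(Lc•a′ + ρ_c) + φ_e(Lc•a′ + ρ_c + Lc•e_{a′.2}))))`,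
`Λʰ a′ := Σ_ā h̄_ā · c^per_ā(a′.2, a′.1)` — the normal form of `PeriodisedLamGaugeLegDoor.torus_a1_lam_Q10` ∕ of `PeriodisedWardOrderOneCompanion.a1_total_eq_zero`'s
`hLam`: a DIAGONAL multiplier reading on the bond `a`, minus the next storey's endpoint readings pulled back through `Qᵀ`.  At `κ = 1` it is the Λ half of the
bottom tables against arbitrary potential gradients; at `(M₁, M₂)` = (storey `k`, storey `k+1`) it is the storey-`k` companion's reading one storey up. -/
theorem torus_lamFamily_mul_grad_potentials_Q {N : ℕ} [NeZero N] (M₁ : Fin (d + 1) → ℕ) [∀ μ, NeZero (M₁ μ)] {M₂ : Fin (d + 1) → ℕ} [∀ μ, NeZero (M₂ μ)]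
    (hM₁ : ∀ i, M₁ i = Lc * M₂ i) (cp : ↥(pbox M₂) → ↥(pbox M₁))
    (hcp : ∀ u : ↥(pbox M₂), ((cp u : ↥(pbox M₁)) : Site (d + 1)) = (Lc : ℤ) • (u : Site (d + 1))) (j : ℕ)
    {Q : Matrix (↥(pbox M₂) × Fin (d + 1)) (↥(pbox M₁) × Fin (d + 1)) ℝ}
    (hQ : Q = (perF M₁ (bhKStepSh d Lc (Dsh Lc) j)).submatrix
        (fun a : ↥(pbox M₂) × Fin (d + 1) => ((cp a.1, Sum.inr a.2) : Idx M₁ (Fib d)))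
        (fun b : ↥(pbox M₁) × Fin (d + 1) => ((b.1, Sum.inl b.2) : Idx M₁ (Fib d))))
    (c : Fin (d + 1) → Site (d + 1) → Fin (d + 1) → Site (d + 1) → ℝ)
    (hc : ∀ κ' u μ y, Summable fun m : Site (d + 1) => c μ (translate M₂ y m) κ' u)
    (w κ : ℝ) (hbar : ↥(pbox M₁) × Fin (d + 1) → ℝ)
    {G : Matrix (↥(pbox M₁) × Fin (d + 1)) (↥(pbox M₁) × Fin (d + 1)) ℝ}
    (hG : G = w • ∑ a : ↥(pbox M₁) × Fin (d + 1), hbar a •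
        (perF M₁ (dper M₁ (SLam N c (fun μ y => symHessFFAt (toSite (ctrOff (d + 1) Lc)) Lc μ y) a.2 (a.1 : Site (d + 1))))).submatrix
          (fun b : ↥(pbox M₁) × Fin (d + 1) => ((b.1, Sum.inl b.2) : Idx M₁ (Fib d)))
          (fun b : ↥(pbox M₁) × Fin (d + 1) => ((b.1, Sum.inl b.2) : Idx M₁ (Fib d))))
    {γ : Type*} (φ : γ → Site (d + 1) → ℝ) (hφ : ∀ e z m, φ e (translate M₁ z m) = φ e z)
    {D : Matrix (↥(pbox M₁) × Fin (d + 1)) γ ℝ}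
    (hD : D = κ • Matrix.of fun (a : ↥(pbox M₁) × Fin (d + 1)) (e : γ) => φ e ((a.1 : Site (d + 1)) + unitVec a.2) - φ e (a.1 : Site (d + 1))) :
    G * D = (w * κ / (2 * (stepScale d Lc j * (Lc : ℝ) ^ (d + 1)))) •
      (Matrix.of (fun (a : ↥(pbox M₁) × Fin (d + 1)) (e : γ) =>
          Qᵀ.mulVec (fun a' : ↥(pbox M₂) × Fin (d + 1) =>
              ∑ ā : ↥(pbox M₁) × Fin (d + 1), hbar ā * ∑' m : Site (d + 1), c a'.2 (translate M₂ (a'.1 : Site (d + 1)) m) ā.2 (ā.1 : Site (d + 1))) a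
            * (φ e (a.1 : Site (d + 1)) + φ e ((a.1 : Site (d + 1)) + unitVec a.2)))
        - Qᵀ * Matrix.of (fun (a' : ↥(pbox M₂) × Fin (d + 1)) (e : γ) =>
          (∑ ā : ↥(pbox M₁) × Fin (d + 1), hbar ā * ∑' m : Site (d + 1), c a'.2 (translate M₂ (a'.1 : Site (d + 1)) m) ā.2 (ā.1 : Site (d + 1)))
            * (φ e ((Lc : ℤ) • (a'.1 : Site (d + 1)) + toSite (ctrOff (d + 1) Lc))
                + φ e ((Lc : ℤ) • (a'.1 : Site (d + 1)) + toSite (ctrOff (d + 1) Lc) + (Lc : ℤ) • unitVec a'.2)))) := by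
  rw [torus_lamFamily_mul_grad_potentials Lc M₁ hM₁ c hc w κ hbar hG φ hφ hD]
  -- the coarse-endpoint readings are `M₂`-periodic in the coarse index
  have hper : ∀ (e : γ) (w' : Site (d + 1)) (y k : Site (d + 1)),
      φ e ((Lc : ℤ) • translate M₂ y k + toSite (ctrOff (d + 1) Lc) + w') = φ e ((Lc : ℤ) • y + toSite (ctrOff (d + 1) Lc) + w') := by
    intro e w' y k
    rw [coarseEnd_translate M₂ Lc (toSite (ctrOff (d + 1) Lc)) y k w']
    obtain rfl : M₁ = fine Lc M₂ := funext hM₁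
    exact hφ e _ k
  have reg : ∀ (e : γ) (a : ↥(pbox M₁) × Fin (d + 1)) (ā : ↥(pbox M₁) × Fin (d + 1)) (μ : Fin (d + 1)),
      ∑' y : Site (d + 1), (∑' m : Site (d + 1), c μ (translate M₂ y m) ā.2 (ā.1 : Site (d + 1))) *
          ((φ e (a.1 : Site (d + 1)) + φ e ((a.1 : Site (d + 1)) + unitVec a.2)
              - φ e ((Lc : ℤ) • y + toSite (ctrOff (d + 1) Lc)) - φ e ((Lc : ℤ) • y + toSite (ctrOff (d + 1) Lc) + (Lc : ℤ) • unitVec μ))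
            * symLinKerAt (toSite (ctrOff (d + 1) Lc)) Lc μ y (a.2, (a.1 : Site (d + 1))) / 2)
        = ∑ y₀ : ↥(pbox M₂), (∑' m : Site (d + 1), c μ (translate M₂ (y₀ : Site (d + 1)) m) ā.2 (ā.1 : Site (d + 1)))
            * (φ e (a.1 : Site (d + 1)) + φ e ((a.1 : Site (d + 1)) + unitVec a.2)
                - φ e ((Lc : ℤ) • (y₀ : Site (d + 1)) + toSite (ctrOff (d + 1) Lc))
                - φ e ((Lc : ℤ) • (y₀ : Site (d + 1)) + toSite (ctrOff (d + 1) Lc) + (Lc : ℤ) • unitVec μ))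
            * Q (y₀, μ) a / (2 * (stepScale d Lc j * (Lc : ℝ) ^ (d + 1))) := by
    intro e a ā μ
    refine tsum_coarse_regroup_pot_gen M₂ Lc M₁ hM₁ cp hcp j hQ c ā.2 (ā.1 : Site (d + 1)) μ a
      (Φ := fun y => φ e (a.1 : Site (d + 1)) + φ e ((a.1 : Site (d + 1)) + unitVec a.2)
              - φ e ((Lc : ℤ) • y + toSite (ctrOff (d + 1) Lc)) - φ e ((Lc : ℤ) • y + toSite (ctrOff (d + 1) Lc) + (Lc : ℤ) • unitVec μ)) (fun y k => ?_)
    have h1 := hper e 0 y k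
    have h2 := hper e ((Lc : ℤ) • unitVec μ) y k
    simp only [add_zero] at h1
    simp only [h1, h2]
  ext a e
  simp only [Matrix.smul_apply, Matrix.of_apply, Matrix.sub_apply, Matrix.mul_apply, Matrix.transpose_apply, smul_eq_mul, Matrix.mulVec, dotProduct, reg]
  exact bookkeeping (w * κ) (2 * (stepScale d Lc j * (Lc : ℝ) ^ (d + 1)))
    (φ e (a.1 : Site (d + 1))) (φ e ((a.1 : Site (d + 1)) + unitVec a.2)) hbar
    (fun μ (y₀ : ↥(pbox M₂)) (b : ↥(pbox M₁) × Fin (d + 1)) => ∑' m : Site (d + 1), c μ (translate M₂ (y₀ : Site (d + 1)) m) b.2 (b.1 : Site (d + 1)))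
    (fun (y₀ : ↥(pbox M₂)) => φ e ((Lc : ℤ) • (y₀ : Site (d + 1)) + toSite (ctrOff (d + 1) Lc)))
    (fun (y₀ : ↥(pbox M₂)) μ => φ e ((Lc : ℤ) • (y₀ : Site (d + 1)) + toSite (ctrOff (d + 1) Lc) + (Lc : ℤ) • unitVec μ))
    (fun a' => Q a' a)

/-! ## §5 The bridge from leaf-02's covariance images: gauge-function families through the torus gradient ARE gradients of periodic potentials -/

omit [∀ μ, NeZero (M' μ)] [NeZero Lc] in
/-- **[folklore] `tgrad_ff_mul_eq_of_grad`** — for ANY family `C` of gauge functions on the sites of a torus `T`,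
`(tgrad T)|ff,id * C = of (v e ↦ φ_e(v.1 + e_{v.2}) − φ_e(v.1))` with the `T`-PERIODIC potentials `φ_e z := C (wrapPt T z) e` (`sum_tdelta_mul`, `wrapPt_of_mem`);
so leaf-02's composite covariance image `(∏ stepScale·#B) • ((tgrad M)|ff,id * C.submatrix itRoot id)` (`TorusCompositeCovarianceSym.compRowsSym_mul_tgrad_mul`) is
§3 ∕ §4's `D` with `φ_e := C (itRoot (wrapPt M ·)) e`. -/
theorem tgrad_ff_mul_eq_of_grad (T : Fin (d + 1) → ℕ) [∀ μ, NeZero (T μ)] {γ : Type*} (C : Matrix ↥(pbox T) γ ℝ) :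
    (tgrad T).submatrix (fun b : ↥(pbox T) × Fin (d + 1) => ((b.1, Sum.inl b.2) : Idx T (Fib d))) id * C
      = Matrix.of fun (v : ↥(pbox T) × Fin (d + 1)) (e : γ) =>
          C (wrapPt T ((v.1 : Site (d + 1)) + unitVec v.2)) e - C (wrapPt T (v.1 : Site (d + 1))) e := by
  ext v e
  rw [Matrix.mul_apply, Matrix.of_apply]
  simp only [Matrix.submatrix_apply, id, tgrad_inl, sub_mul, Finset.sum_sub_distrib, sum_tdelta_mul]

omit [∀ μ, NeZero (M' μ)] [NeZero Lc] in
/-- [folklore] the potentials `φ_e z := C (wrapPt T z) e` are `T`-periodic (`wrapPt` does not see the translate). -/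
theorem wrapPt_translate (T : Fin (d + 1) → ℕ) [∀ μ, NeZero (T μ)] (z m : Site (d + 1)) : wrapPt T (translate T z m) = wrapPt T z := by
  have h1 := TorusGaugeCovariancePairing.tdelta_eq_ite_wrapPt T (translate T z m) (wrapPt T z)
  rw [TorusGaugeCovariance.tdelta_translate, TorusGaugeCovariancePairing.tdelta_eq_ite_wrapPt, if_pos rfl] at h1
  by_contra hne
  rw [if_neg hne] at h1
  exact one_ne_zero h1

omit [∀ μ, NeZero (M' μ)] [NeZero Lc] in
/-- [folklore] at a torus site the potential reads the family itself: `φ_e v = C v e` (`wrapPt_of_mem`). -/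
theorem wrapPt_coe_eq (T : Fin (d + 1) → ℕ) [∀ μ, NeZero (T μ)] (v : ↥(pbox T)) : wrapPt T (v : Site (d + 1)) = v := wrapPt_of_mem T v

end Summit.QuantumFields.BalabanUV.Beta.FP.PeriodisedWardOrderOnePotentials

end
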